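import Summits.BirchSwinnertonDyer.BirchSwinnertonDyer.Theses.GoldfeldAllTwistsTwoConverse
import Summits.BirchSwinnertonDyer.BirchSwinnertonDyer.Theorems.GoldfeldGoodTwistsAllTwistsCells
import Literature.NumberTheory.EllipticCurves.CoatesLiTianZhai2015.QuadraticTwistsX049
import Literature.NumberTheory.EllipticCurves.ComplexMultiplicationTwistIsogenyCertProofs
import Literature.NumberTheory.EllipticCurves.ComplexMultiplicationLFunctionTableProofs
import Literature.NumberTheory.EllipticCurves.QuadraticTwistLocalDataAtTwoHoldsProofs
import Literature.NumberTheory.EllipticCurves.BSDSelmerParityDokchitserBaseChangeProofs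
import Literature.NumberTheory.EllipticCurves.LeadingTermProofs
import Literature.NumberTheory.EllipticCurves.HeegnerPointsImaginaryQuadraticProofs
import Literature.NumberTheory.EllipticCurves.IsogenyIdProofs
import Literature.NumberTheory.QuadraticFields.FundamentalDiscriminant
import HarnessLib

set_option linter.dupNamespace false
set_option autoImplicit false

/-!
# Crux K12₂″ by QUADRATIC BASE CHANGE: the additive-at-`2` rank-one `2`-converse for the
# `ℚ(√−7)`-twists is EQUIVALENT to a `K`-level `2`-converse for the ONE good-ordinary curve
# `X₀(49)` over the imaginary quadratic fields of EVEN discriminant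

Cell `bsd-goldfeld`, prover seat `s1p-c201`, item `stmt-BirchSwinnertonDyer-20044`
(`Theses.GoldfeldAllTwistsTwoConverse.RankOneTwoConverseCMSevenAdditiveTwo`, K12₂″: for every globally
minimal elliptic `W/ℚ` with `j(W) = −3375` that does NOT have good reduction at `2`,
`corank_{ℤ₂} Sel_{2^∞}(W/ℚ) = 1 ⟹ ord_{s=1} L(W, s) = 1`). This file does not prove K12₂″ (open
mathematics: Burungale–Castella–Skinner–Tian 2022, Rem. D; Li–Tian–Yan–Zhu 2025, §1.3 (II)). It proves,
sorry-free, that K12₂″ is EQUIVALENT — modulo two published inputs taken as cite-tagged hypotheses —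
to the following statement about ONE elliptic curve with GOOD ORDINARY reduction at `2`:

* `X049KLevelTwoConverseEvenDiscr` (**OPEN, nothing asserted**): for every imaginary quadratic field
  `K` with `4 ∣ d_K` (i.e. `2` RAMIFIED in `K`), `corank_{ℤ₂} Sel_{2^∞}(E₀/K) = 1 ⟹ ord_{s=1} L(E₀/K, s) = 1`,
  where `E₀ = X₀(49) = 49a1` is the tree's `cm7 = [1, −1, 0, −2, −1]`, `L(E₀/K, s) = L(E₀, s) L(E₀^{(d_K)}, s)`.

So the additivity at `2` moves from the CURVE (the twists `49a1^{(d)}`, `d ≢ 1 (mod 4)`: additive,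
potentially good ordinary at `2`, `E[2](ℚ) = ℤ/2`) to the BASE FIELD (`2` ramified in `K`) of ONE modular
curve of conductor `49`, good ordinary at `2`: the hypothesis "(disc) `d_K` odd" of the printed `K`-level
`p`-converses (Burungale–Castella–Grossi–Skinner Thm. 1 / Cor. 1, `p` odd) is what fails, with `p = 2` and
(tor)/(irr); the leaf is the natural target of a Heegner-point / `2`-adic anticyclotomic argument over `K`.

## The mechanism (all steps are tree theorems)

Given `W` as in K12₂″: `W ≅_ℚ E₀^{(n)}` with `n` a squarefree integer (*AEC* X.5.4,
`exists_variableChange_eq_quadraticTwist_of_j_eq` + `Rat.exists_sq_mul_squarefree`); `W` not good at `2`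
forces `n ≢ 1 (mod 4)` (the tree's local analysis at `2`,
`hasGoodReductionAtPrime_and_frobeniusTrace_of_smul_eq_quadraticTwist_two`); replacing `n` by `−7n`
(or `−n/7`) does not change the isogeny class (`E₀ ∼ E₀^{(−7)}`, the kernel-certified `7`-isogeny
`isIsogenous_cm7_quadraticTwist`, twisted by `n`), so `n < 0` may be assumed; `K := ℚ(√n)` has
`d_K = 4n` (`QuadraticFields.Quadratic.exists_numberField_discr_eq`) and `E₀^{(d_K)} ≅ E₀^{(n)} ∼ W`;
`corank Sel_{2^∞}(E₀/K) = corank Sel_{2^∞}(E₀/ℚ) + corank Sel_{2^∞}(E₀^{(d_K)}/ℚ) = 0 + 1`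
(T. Dokchitser's base-change count, tree theorem `selmerCorank_baseChange_quadratic_holds`, valid at
`p = 2`; `corank(E₀/ℚ) = 0` as `rank E₀(ℚ) = 0`, `Ш(E₀)` finite); the leaf gives
`ord L(E₀/K) = 1 = ord L(E₀) + ord L(E₀^{(d_K)}) = 0 + ord L(W)` (`analyticRankEK_eq_add_of`, isogeny
invariance). Conversely, for `d_K = 4m` a minimal model `W'` of `E₀^{(m)}` has `j = −3375` and is NOT good
at `2` (Barrios et al. 2025 Thm. 5.1, rows `I₀`, a tree THEOREM: Kodaira `I₄*`/`II*`/`I₈*`/`II`), and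
K12₂″ for `W'` gives the leaf.

## Published inputs (hypotheses, cite-tagged tree `Prop`s; nothing new)

* `hmod : WeierstrassCurve.hasEntireLFunction_rat` — analytic continuation of `L(E, s)` (modularity; a
  conjunct of the route's `PublishedFactsAllTwists`);
* `h12 : CoatesLiTianZhai2015.thm12_fullBSD_twist` — Coates–Li–Tian–Zhai, PLMS 110 (2015) Thm. 1.2, used
  ONLY at `R = 1`: `L(X₀(49), 1) ≠ 0`, `X₀(49)(ℚ)` finite, `Ш` finite (the tree's `bsdTriple_cm7_of_thm12`).

## Main results

* `X049KLevelTwoConverseEvenDiscr` — the leaf (closed `Prop`, `@[conjecture]`, nothing asserted);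
* `rankOneTwoConverseCMSevenAdditiveTwo_of_kLevelEvenDiscr hmod h12 : leaf → K12₂″` (type = the route decl
  `…Theses.GoldfeldAllTwistsTwoConverse.RankOneTwoConverseCMSevenAdditiveTwo`), its converse
  `kLevelEvenDiscr_of_rankOneTwoConverseCMSevenAdditiveTwo`, the `iff`, and the parent K12₂′ from the leaf
  + BCST Thm. A (`rankOneTwoConverseCMSevenAtAnyTwo_of_kLevelEvenDiscr`, via file 13).

No `sorry`, no new axiom, no instance, no notation.
References: Coates–Li–Tian–Zhai, PLMS 110 (2015), Thm. 1.2 [CoatesLiTianZhai2015]; Burungale–Castella–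
Skinner–Tian, Ann. Math. Qué. 46 (2022), Rem. D [BurungaleCastellaSkinnerTian2022]; Burungale–Castella–
Grossi–Skinner, arXiv:2312.09301, Thm. 1 / Cor. 1 [BurungaleEtAl2026]; T. Dokchitser, parity notes (2013) §4
[Dokchitser2013ParityNotes]; Barrios et al., Res. Number Theory 11 (2025) Thm. 5.1 [BarriosEtAl2025];
Silverman, *AEC* X.5 [SilvermanAEC2009]; Gross–Zagier, Invent. Math. 84 (1986) I.§7 [GrossZagier1986].
-/

noncomputable section

open scoped Classical

open WeierstrassCurve Literature.NumberTheory Literature.NumberTheory.EllipticCurves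

namespace Summit.BirchSwinnertonDyer.BirchSwinnertonDyer.Theorems.GoldfeldGoodTwists

/-! ## §1 The leaf: a `K`-level `2`-converse for `X₀(49)` over even-discriminant imaginary quadratic fields -/

/-- **LEAF `X049KLevelTwoConverseEvenDiscr` (OPEN; nothing asserted).** For every imaginary quadratic
field `K` whose discriminant is divisible by `4` (equivalently: `2` ramifies in `K`; `K = ℚ(√m)`,
`m ≡ 2, 3 (mod 4)` squarefree), the rank-one `2^∞`-Selmer converse for `E₀ = X₀(49) = 49a1` (the tree's
minimal model `cm7`, CM by `ℤ[(1+√−7)/2]`, good ORDINARY reduction at `2`) over `K`: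
`corank_{ℤ₂} Sel_{2^∞}(E₀/K) = 1 ⟹ ord_{s=1} L(E₀/K, s) = 1`, where `L(E₀/K, s) = L(E₀, s) L(E₀^{(d_K)}, s)`
(`analyticRankEK`). Equivalent to crux K12₂″ modulo print (this file, §5–§6). The printed `K`-level
converses exclude it thrice: `p = 2`, `d_K` even (BCGS hypothesis (disc)), `E₀(ℚ)[2] = ℤ/2` ((tor), (irr)).
[cite: BurungaleCastellaSkinnerTian2022, Rem. D (p. 327)]
[cite: BurungaleEtAl2026, Thm. 1 and Cor. 1 (arXiv:2312.09301, §0.1, pp. 3–4) — hypotheses (disc), (tor), p odd] -/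
@[conjecture] def X049KLevelTwoConverseEvenDiscr : Prop :=
  ∀ (K : Type) [Field K] [NumberField K], IsImaginaryQuadratic K → (4 : ℤ) ∣ NumberField.discr K →
    (cm7.baseChange K).selmerCorank 2 = 1 → analyticRankEK cm7 K = 1

/-! ## §2 The curves with `j = −3375` as squarefree twists of `X₀(49)`; the additive ones -/

/-- Every elliptic `W/ℚ` with `j(W) = −3375` is `ℚ`-isomorphic to the twist `E₀^{(n)}` of `E₀ = cm7` by a
SQUAREFREE integer `n`: `C • W = E₀^{(d)}` for some `d ∈ ℚˣ` (*AEC* X.5.4, `j ≠ 0, 1728`), `d = c² n`,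
and `E₀^{(c²n)} ≅ E₀^{(n)}`. [cite: SilvermanAEC2009, X.5 Prop. 5.4 and Cor. 5.4.1] -/
theorem exists_squarefree_smul_eq_quadraticTwist_cm7 (W : WeierstrassCurve ℚ) [W.IsElliptic]
    (hj : W.j = -3375) :
    ∃ (n : ℤ) (C : VariableChange ℚ), Squarefree n ∧ C • W = cm7.quadraticTwist (n : ℚ) := by
  have hjE : W.j = cm7.j := by rw [hj, j_cm7]
  obtain ⟨d, hd, C, hC⟩ := exists_variableChange_eq_quadraticTwist_of_j_eq hjE
    (by rw [j_cm7]; norm_num) (by rw [j_cm7]; norm_num)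
  obtain ⟨c, n, hc, hsq, rfl⟩ := Rat.exists_sq_mul_squarefree hd
  refine ⟨n, (⟨(Units.mk0 c hc)⁻¹, 0, 0, 0⟩ : VariableChange ℚ)⁻¹ * C, hsq, ?_⟩
  rw [mul_smul, hC, cm7.quadraticTwist_sq_mul hc, inv_smul_smul]

/-- If a globally minimal `W ≅ E₀^{(n)}` does NOT have good reduction at `2`, then `n ≢ 1 (mod 4)`:
for `n ≡ 1 (mod 4)` the twisting character is unramified at `2` and good reduction of `E₀` at `2`
persists (tree theorem `hasGoodReductionAtPrime_and_frobeniusTrace_of_smul_eq_quadraticTwist_two`).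
[cite: SilvermanAEC2009, VII.5 Prop. 5.1(a) and X.5 Cor. 5.4.1] -/
theorem emod_four_ne_one_of_not_hasGoodReductionAtPrime_two (W : WeierstrassCurve ℚ) [W.IsElliptic]
    [W.IsGloballyMinimal] {n : ℤ} {C : VariableChange ℚ} (hC : C • W = cm7.quadraticTwist (n : ℚ))
    (hbad : ¬ W.HasGoodReductionAtPrime 2) : n % 4 ≠ 1 := fun h4 ↦
  hbad (hasGoodReductionAtPrime_and_frobeniusTrace_of_smul_eq_quadraticTwist_two cm7 W h4 hC 2 rfl
    hasGoodReductionAtPrime_cm7_two).1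

/-- **Twists by `d ≡ 2, 3 (mod 4)` of a curve with good reduction at `2` are NOT good at `2`** (any
model). Barrios–Roy–Sahajpal–Tallana–Tobin–Wiersema 2025, Thm. 5.1, rows `I₀` (a tree theorem,
`BarriosEtAl2025_quadraticTwist_two_of_goodReduction_holds`): over `ℚ₂` the twist has Kodaira type `I₄*`
or `II*` (`d ≡ 3`), `I₈*` or `II` (`d ≡ 2 (mod 4)`), whereas good reduction means type `I₀`; the Kodaira
symbol is a `ℚ₂`-isomorphism invariant (`kodairaSymbol_smul_holds`).
[cite: BarriosEtAl2025, Thm. 5.1 with the rows R = I₀ of the §5 tables (arXiv:2501.03209 pp. 15–16)]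
[cite: SilvermanATAEC1994, IV.9.4 (Tate's algorithm, Step 1)] -/
theorem not_hasGoodReductionAtPrime_two_of_smul_eq_quadraticTwist (E W' : WeierstrassCurve ℚ)
    [E.IsElliptic] [W'.IsElliptic] (hE : E.HasGoodReductionAtPrime 2) {d : ℤ}
    (hd : d % 4 = 2 ∨ d % 4 = 3) {C : VariableChange ℚ} (hC : C • W' = E.quadraticTwist (d : ℚ)) :
    ¬ W'.HasGoodReductionAtPrime 2 := by
  intro hgood
  haveI := TwistGoodTwo.perfectField_residueField_padicInt
  -- Barrios et al. for `E ⊗ ℚ₂`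
  have hB := BarriosEtAl2025_quadraticTwist_two_of_goodReduction_holds (E.baseChange ℚ_[2]) hE d
  -- `W' ⊗ ℚ₂ ≅ (E ⊗ ℚ₂)^{(d)}`
  have hbc : (C.map (algebraMap ℚ ℚ_[2])) • W'.baseChange ℚ_[2] =
      (E.baseChange ℚ_[2]).quadraticTwist (d : ℚ_[2]) := by
    simp only [WeierstrassCurve.baseChange]
    rw [map_variableChange, hC, map_quadraticTwist, map_intCast]
  -- good reduction of `W'` at `2`: Kodaira symbol `I₀`
  have hI0 : (W'.baseChange ℚ_[2]).kodairaSymbol ℤ_[2] = .I 0 := by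
    haveI : ((W'.baseChange ℚ_[2]).minimal ℤ_[2]).HasGoodReduction ℤ_[2] := hgood
    unfold WeierstrassCurve.kodairaSymbol
    exact TwistGoodTwo.kodairaSymbolOfMinimal_eq_I_zero_of_isUnit_Δ _
      (TwistGoodTwo.isUnit_Δ_integralModel_of_hasGoodReduction _)
  have hK : ((E.baseChange ℚ_[2]).quadraticTwist (d : ℚ_[2])).kodairaSymbol ℤ_[2] = .I 0 := by
    rw [← hbc, kodairaSymbol_smul_holds ℤ_[2] (W'.baseChange ℚ_[2]), hI0]
  rcases hd with h2 | h3
  · obtain ⟨h, -⟩ := hB.2.2 (by unfold Int.ModEq; omega)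
    rw [hK] at h
    rcases h with h | h <;> exact absurd h (by decide)
  · obtain ⟨h, -⟩ := hB.2.1 (by unfold Int.ModEq; omega)
    rw [hK] at h
    rcases h with h | h <;> exact absurd h (by decide)

/-- **`E₀^{(n)} ∼ E₀^{(−7n)}` over `ℚ`** (`n ≠ 0`): the kernel-certified `7`-isogeny `E₀ ∼ E₀^{(−7)}`
(`isIsogenous_cm7_quadraticTwist`; `[√−7] ∈ End(E₀)`) twisted by `n` ("twisting commutes with
isogenies"). Coates–Li–Tian–Zhai: "for a discriminant `d` prime to `7`, the curves `A^{(d)}` and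
`A^{(−7d)}` are isogenous over `ℚ`". [cite: CoatesLiTianZhai2015, §1 (p. 359, the curve A)]
[cite: SilvermanAEC2009, X.5 Prop. 5.4] -/
theorem isIsogenous_quadraticTwist_cm7_neg_seven_mul {n : ℤ} (hn : n ≠ 0) :
    IsIsogenous (cm7.quadraticTwist (n : ℚ)) (cm7.quadraticTwist ((-7 * n : ℤ) : ℚ)) := by
  have hnQ : (n : ℚ) ≠ 0 := Int.cast_ne_zero.mpr hn
  have h := isIsogenous_cm7_quadraticTwist.quadraticTwist hnQ
  rwa [quadraticTwist_quadraticTwist,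
    show ((-7 : ℚ) * n) = ((-7 * n : ℤ) : ℚ) by push_cast; ring] at h

/-- **A NEGATIVE squarefree twist parameter in the same class mod `4` and the same isogeny class.**
For squarefree `n`: if `n < 0` take `n' = n`; if `n > 0` and `7 ∤ n` take `n' = −7n`; if `n = 7m > 0`
take `n' = −m` (`E₀^{(7m)} = (E₀^{(−7)})^{(−m)} ∼ E₀^{(−m)}`); in all cases `n' ≡ n (mod 4)` since
`−7 ≡ 1 (mod 8)`. [cite: CoatesLiTianZhai2015, §1 (p. 359)] [cite: SilvermanAEC2009, X.5 Prop. 5.4] -/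
theorem exists_neg_squarefree_isIsogenous_quadraticTwist_cm7 {n : ℤ} (hsq : Squarefree n) :
    ∃ n' : ℤ, Squarefree n' ∧ n' < 0 ∧ n' % 4 = n % 4 ∧
      IsIsogenous (cm7.quadraticTwist (n : ℚ)) (cm7.quadraticTwist (n' : ℚ)) := by
  have hn : n ≠ 0 := hsq.ne_zero
  have hnQ : (n : ℚ) ≠ 0 := Int.cast_ne_zero.mpr hn
  haveI := cm7.isElliptic_quadraticTwist hnQ
  rcases lt_or_gt_of_ne hn with hneg | hpos
  · exact ⟨n, hsq, hneg, rfl, isIsogenous_self _⟩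
  · by_cases h7 : (7 : ℤ) ∣ n
    · obtain ⟨m, rfl⟩ := h7
      have hm : -m ≠ 0 := by
        intro h
        apply hn
        omega
      have hmQ : ((-m : ℤ) : ℚ) ≠ 0 := Int.cast_ne_zero.mpr hm
      haveI := cm7.isElliptic_quadraticTwist hmQ
      refine ⟨-m, hsq.squarefree_of_dvd ⟨-7, by ring⟩, by omega, by omega, ?_⟩
      have h := isIsogenous_quadraticTwist_cm7_neg_seven_mul hm
      rw [show (-7 * -m : ℤ) = 7 * m by ring] at h
      exact h.symm_of_isElliptic
    · refine ⟨-7 * n, ?_, by omega, by omega, isIsogenous_quadraticTwist_cm7_neg_seven_mul hn⟩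
      have h7' : ¬ 7 ∣ n.natAbs := fun h ↦ h7 (Int.ofNat_dvd_left.mpr h)
      have hcop : Nat.Coprime 7 n.natAbs := (Nat.Prime.coprime_iff_not_dvd (by norm_num)).mpr h7'
      rw [← Int.squarefree_natAbs, Int.natAbs_mul, Int.natAbs_neg,
        show (7 : ℤ).natAbs = 7 from rfl, Nat.squarefree_mul hcop]
      exact ⟨(show Nat.Prime 7 by norm_num).prime.squarefree, Int.squarefree_natAbs.mpr hsq⟩

/-! ## §3 `X₀(49)` itself: `L(E₀, 1) ≠ 0`, `corank Sel_{2^∞}(E₀/ℚ) = 0`, `ord_{s=1} L(E₀, s) = 0` -/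

/-- From Coates–Li–Tian–Zhai Thm. 1.2 at `R = 1` (`r = 0`): `L(E₀, 1) ≠ 0`, `rank E₀(ℚ) = 0` and
`Ш(E₀/ℚ)` is finite, on the minimal model `cm7` (the tree's `bsdTriple_cm7_of_thm12`; `E₀^{(1)} ≅ E₀`).
[cite: CoatesLiTianZhai2015, Thm. 1.2 (p. 359, case r = 0)] -/
theorem cm7_L_one_ne_zero_rank_zero_shaFinite (h12 : CoatesLiTianZhai2015.thm12_fullBSD_twist) :
    cm7.entireLFunction 1 ≠ 0 ∧ cm7.mordellWeilRank = 0 ∧ cm7.ShaFinite := by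
  have hC : ∃ C : VariableChange ℚ, C • cm7 = cm7.quadraticTwist ((1 : ℕ) : ℚ) := by
    rw [Nat.cast_one]
    exact cm7.exists_variableChange_quadraticTwist_one
  obtain ⟨hL, hrank, hsha, -, -⟩ := CoatesLiTianZhai2015.bsdTriple_cm7_of_thm12 h12 hC
  exact ⟨hL, hrank, hsha⟩

/-- `corank_{ℤ₂} Sel_{2^∞}(E₀/ℚ) = 0` for `E₀ = X₀(49)`: `rank = 0` and `Ш(E₀)[2^∞]` finite, by the
corank identity `s_p = r + t_p` (Greenberg 1999 §1, tree theorem).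
[cite: CoatesLiTianZhai2015, Thm. 1.2 (p. 359, case r = 0)] [cite: Greenberg1999LNM, §1 pp. 54–57] -/
theorem selmerCorank_cm7_two (h12 : CoatesLiTianZhai2015.thm12_fullBSD_twist) :
    cm7.selmerCorank 2 = 0 := by
  obtain ⟨-, hrank, hsha⟩ := cm7_L_one_ne_zero_rank_zero_shaFinite h12
  haveI : Finite cm7.sha := hsha
  rw [selmerCorank_eq_mordellWeilRank_of_finite_shaPrimary cm7 2 inferInstance, hrank]

/-- `ord_{s=1} L(E₀, s) = 0` for `E₀ = X₀(49)` (`L(E₀, 1) ≠ 0`).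
[cite: CoatesLiTianZhai2015, Thm. 1.2 (p. 359, case r = 0)] -/
theorem analyticRank_cm7 (h12 : CoatesLiTianZhai2015.thm12_fullBSD_twist) : cm7.analyticRank = 0 :=
  analyticRank_eq_zero_of_entireLFunction_one_ne_zero cm7 (cm7_L_one_ne_zero_rank_zero_shaFinite h12).1

/-! ## §4 Bookkeeping over a quadratic field `K`: everything is carried by the twist `E₀^{(d_K)}` -/

/-- `corank_{ℤ₂} Sel_{2^∞}(E₀/K) = corank_{ℤ₂} Sel_{2^∞}(E₀^{(d_K)}/ℚ)` for a quadratic field `K`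
(T. Dokchitser's base-change count `corank(E/K) = corank(E/ℚ) + corank(E^{(d_K)}/ℚ)`, tree theorem
`selmerCorank_baseChange_quadratic_holds`, and `corank(E₀/ℚ) = 0`).
[cite: Dokchitser2013ParityNotes, §4, proof of the Theorem "[Squarity, NekIV, Kurast]", first display]
[cite: CoatesLiTianZhai2015, Thm. 1.2 (p. 359, case r = 0)] -/
theorem selmerCorank_cm7_baseChange (h12 : CoatesLiTianZhai2015.thm12_fullBSD_twist) (K : Type)
    [Field K] [NumberField K] (h2 : Module.finrank ℚ K = 2) :
    (cm7.baseChange K).selmerCorank 2 =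
      (cm7.quadraticTwist (NumberField.discr K : ℚ)).selmerCorank 2 := by
  rw [selmerCorank_baseChange_quadratic_holds cm7 K h2 2, selmerCorank_cm7_two h12, zero_add]

/-- `ord_{s=1} L(E₀/K, s) = ord_{s=1} L(E₀^{(d_K)}, s)` (Artin formalism `L(E₀/K, s) = L(E₀, s) L(E₀^{(d_K)}, s)`
given analytic continuation, tree theorem `analyticRankEK_eq_add_of`, and `ord L(E₀, s) = 0`).
[cite: GrossZagier1986, I.§7] [cite: CoatesLiTianZhai2015, Thm. 1.2 (p. 359, case r = 0)] -/
theorem analyticRankEK_cm7 (hmod : hasEntireLFunction_rat)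
    (h12 : CoatesLiTianZhai2015.thm12_fullBSD_twist) (K : Type) [Field K] [NumberField K] :
    analyticRankEK cm7 K = (cm7.quadraticTwist (NumberField.discr K : ℚ)).analyticRank := by
  rw [analyticRankEK_eq_add_of hmod cm7 K, analyticRank_cm7 h12, zero_add]

/-- `E₀^{(4m)} = ⟨2⁻¹, 0, 0, 0⟩ • E₀^{(m)}`: twisting by `d_K = 4m` is twisting by `m` up to a
`ℚ`-isomorphism. [cite: SilvermanAEC2009, X.5 Prop. 5.4] -/
theorem quadraticTwist_cm7_four_mul (m : ℤ) :
    cm7.quadraticTwist ((4 * m : ℤ) : ℚ) =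
      (⟨(Units.mk0 (2 : ℚ) two_ne_zero)⁻¹, 0, 0, 0⟩ : VariableChange ℚ) •
        cm7.quadraticTwist (m : ℚ) := by
  rw [show ((4 * m : ℤ) : ℚ) = (2 : ℚ) ^ 2 * (m : ℚ) by push_cast; ring]
  exact cm7.quadraticTwist_sq_mul two_ne_zero _

/-! ## §5 The reduction: the leaf implies K12₂″ (type = the route decl, fully qualified) -/

/-- **K12₂″ from the leaf.** Assume analytic continuation (`hmod`), Coates–Li–Tian–Zhai Thm. 1.2 at
`R = 1` (`h12`: `L(X₀(49),1) ≠ 0`, rank `0`, `Ш` finite) and the leaf `X049KLevelTwoConverseEvenDiscr`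
(`hX`). Then for every globally minimal `W/ℚ` with `j = −3375`, NOT good at `2`, of `2^∞`-Selmer corank
`1`: `ord_{s=1} L(W, s) = 1`. Proof: `W ≅ E₀^{(n)}`, `n` squarefree, `n ≢ 1 (mod 4)` (§2); pass to a
negative `n' ∼ n` (§2); `K = ℚ(√n')`, `d_K = 4n'`, `E₀^{(d_K)} ≅ E₀^{(n')} ∼ W`;
`corank Sel_{2^∞}(E₀/K) = 0 + corank(W) = 1` (§4); the leaf gives `ord L(E₀/K) = 1 = 0 + ord L(W)`.
[cite: CoatesLiTianZhai2015, Thm. 1.2 (p. 359, case r = 0)]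
[cite: Dokchitser2013ParityNotes, §4 (first display)] [cite: SilvermanAEC2009, X.5 Prop. 5.4 and Cor. 5.4.1]
[cite: BurungaleCastellaSkinnerTian2022, Rem. D (p. 327) (the cell is the excluded case)] -/
theorem rankOneTwoConverseCMSevenAdditiveTwo_of_kLevelEvenDiscr (hmod : hasEntireLFunction_rat)
    (h12 : CoatesLiTianZhai2015.thm12_fullBSD_twist) (hX : X049KLevelTwoConverseEvenDiscr) :
    Summit.BirchSwinnertonDyer.BirchSwinnertonDyer.Theses.GoldfeldAllTwistsTwoConverse.RankOneTwoConverseCMSevenAdditiveTwo := by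
  intro W _ _ hj hbad hsel
  -- `W ≅ E₀^{(n)}`, `n` squarefree, `n ≢ 1 (mod 4)`
  obtain ⟨n, C, hsq, hC⟩ := exists_squarefree_smul_eq_quadraticTwist_cm7 W hj
  have hn4 : n % 4 ≠ 1 := emod_four_ne_one_of_not_hasGoodReductionAtPrime_two W hC hbad
  -- a negative representative `n' ∼ n`
  obtain ⟨n', hsq', hneg, hmod4, hiso⟩ := exists_neg_squarefree_isIsogenous_quadraticTwist_cm7 hsq
  have hnQ : (n : ℚ) ≠ 0 := Int.cast_ne_zero.mpr hsq.ne_zero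
  have hn'0 : n' ≠ 0 := hsq'.ne_zero
  have hn'Q : (n' : ℚ) ≠ 0 := Int.cast_ne_zero.mpr hn'0
  haveI := cm7.isElliptic_quadraticTwist hnQ
  haveI := cm7.isElliptic_quadraticTwist hn'Q
  -- `n' ≡ 2, 3 (mod 4)`
  have hn'sq4 : ¬ (4 : ℤ) ∣ n' := fun h4 ↦ by
    have h22 : (2 : ℤ) * 2 ∣ n' := by rwa [show (2 : ℤ) * 2 = 4 by norm_num]
    have hu := Int.isUnit_iff.mp (hsq' 2 h22)
    omega
  have hres : n' % 4 = 2 ∨ n' % 4 = 3 := by omega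
  -- `K = ℚ(√n')`, `d_K = 4 n'`
  obtain ⟨K, _, _, h2, hdK⟩ := QuadraticFields.Quadratic.exists_numberField_discr_eq (D := 4 * n')
    (Or.inr ⟨dvd_mul_right 4 n', by rw [show 4 * n' / 4 = n' by omega]; exact hres,
      by rw [show 4 * n' / 4 = n' by omega]; exact hsq'⟩)
  have hK : IsImaginaryQuadratic K :=
    isImaginaryQuadratic_iff_discr_neg.mpr ⟨h2, by rw [hdK]; omega⟩
  have h4K : (4 : ℤ) ∣ NumberField.discr K := hdK ▸ dvd_mul_right 4 n'
  -- `E₀^{(d_K)} ≅ E₀^{(n')}`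
  have htw : cm7.quadraticTwist (NumberField.discr K : ℚ) =
      (⟨(Units.mk0 (2 : ℚ) two_ne_zero)⁻¹, 0, 0, 0⟩ : VariableChange ℚ) •
        cm7.quadraticTwist (n' : ℚ) := by
    rw [hdK]; exact quadraticTwist_cm7_four_mul n'
  haveI : (cm7.quadraticTwist (NumberField.discr K : ℚ)).IsElliptic := by rw [htw]; infer_instance
  -- `W ∼ E₀^{(n)} ∼ E₀^{(n')} ∼ E₀^{(d_K)}`
  have hWdK : IsIsogenous W (cm7.quadraticTwist (NumberField.discr K : ℚ)) := by
    rw [htw]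
    exact ((isIsogenous_of_smul_eq hC).trans' hiso).trans' (isIsogenous_smul _ _)
  -- the corank over `K` is `0 + 1`
  have hselK : (cm7.baseChange K).selmerCorank 2 = 1 := by
    rw [selmerCorank_cm7_baseChange h12 K h2, ← hWdK.selmerCorank_eq 2, hsel]
  -- the leaf, then Artin formalism
  have hEK := hX K hK h4K hselK
  rw [analyticRankEK_cm7 hmod h12 K, ← analyticRank_eq_of_isIsogenous' hWdK] at hEK
  exact hEK

/-! ## §6 The converse: K12₂″ implies the leaf -/

/-- **The leaf from K12₂″.** Assume `hmod`, `h12` and K12₂″ (`hXL`, the route decl). For an imaginary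
quadratic `K` with `4 ∣ d_K`: `d_K = 4m`, `m ≡ 2, 3 (mod 4)` squarefree (fundamental discriminant);
a globally minimal model `W'` of `E₀^{(m)} ≅ E₀^{(d_K)}` (Silverman VIII.8.3 over `ℚ`) has `j = −3375`,
is NOT good at `2` (Barrios et al., §2) and has `corank Sel_{2^∞}(W') = corank Sel_{2^∞}(E₀/K) = 1`;
K12₂″ gives `ord L(W', s) = 1`, hence `ord L(E₀/K, s) = 0 + 1`.
[cite: BarriosEtAl2025, Thm. 5.1 (rows R = I₀)] [cite: CoatesLiTianZhai2015, Thm. 1.2 (case r = 0)]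
[cite: Dokchitser2013ParityNotes, §4 (first display)] [cite: SilvermanAEC2009, VIII.8 Cor. 8.3 and X.5 Cor. 5.4.1] -/
theorem kLevelEvenDiscr_of_rankOneTwoConverseCMSevenAdditiveTwo (hmod : hasEntireLFunction_rat)
    (h12 : CoatesLiTianZhai2015.thm12_fullBSD_twist)
    (hXL : Summit.BirchSwinnertonDyer.BirchSwinnertonDyer.Theses.GoldfeldAllTwistsTwoConverse.RankOneTwoConverseCMSevenAdditiveTwo) :
    X049KLevelTwoConverseEvenDiscr := by
  intro K _ _ hK h4 hselK
  -- `d_K = 4m`, `m ≡ 2, 3 (mod 4)` squarefree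
  obtain ⟨k, hk⟩ := h4
  have hfd := QuadraticFields.Quadratic.isFundamentalDiscriminant_discr hK.1
  have hm : (NumberField.discr K / 4 % 4 = 2 ∨ NumberField.discr K / 4 % 4 = 3) ∧
      Squarefree (NumberField.discr K / 4) := by
    rcases hfd with ⟨h1, -, -⟩ | ⟨-, h23, hsq⟩
    · exfalso; omega
    · exact ⟨h23, hsq⟩
  set m : ℤ := NumberField.discr K / 4 with hm_def
  have hdK : NumberField.discr K = 4 * m := by omega
  have hm0 : m ≠ 0 := hm.2.ne_zero
  have hmQ : (m : ℚ) ≠ 0 := Int.cast_ne_zero.mpr hm0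
  haveI := cm7.isElliptic_quadraticTwist hmQ
  -- a globally minimal model `W'` of `E₀^{(m)}`
  obtain ⟨C', hmin⟩ := hasGlobalMinimalModel_rat_holds (cm7.quadraticTwist (m : ℚ))
  haveI := hmin
  have hC' : C'⁻¹ • (C' • cm7.quadraticTwist (m : ℚ)) = cm7.quadraticTwist (m : ℚ) := inv_smul_smul _ _
  obtain ⟨hj, -, -⟩ := minimalModel_quadraticTwist_cm7 hm0 (C' • cm7.quadraticTwist (m : ℚ)) C'⁻¹ hC'
  have hbad : ¬ (C' • cm7.quadraticTwist (m : ℚ)).HasGoodReductionAtPrime 2 :=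
    not_hasGoodReductionAtPrime_two_of_smul_eq_quadraticTwist cm7 _ hasGoodReductionAtPrime_cm7_two
      hm.1 hC'
  -- `E₀^{(d_K)} ≅ E₀^{(m)} ≅ W'`
  have htw : cm7.quadraticTwist (NumberField.discr K : ℚ) =
      (⟨(Units.mk0 (2 : ℚ) two_ne_zero)⁻¹, 0, 0, 0⟩ : VariableChange ℚ) •
        cm7.quadraticTwist (m : ℚ) := by
    rw [hdK]; exact quadraticTwist_cm7_four_mul m
  haveI : (cm7.quadraticTwist (NumberField.discr K : ℚ)).IsElliptic := by rw [htw]; infer_instance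
  have hiso : IsIsogenous (C' • cm7.quadraticTwist (m : ℚ))
      (cm7.quadraticTwist (NumberField.discr K : ℚ)) := by
    rw [htw]
    exact (isIsogenous_of_smul _ _).trans' (isIsogenous_smul _ _)
  -- corank and analytic rank
  have hsel' : (C' • cm7.quadraticTwist (m : ℚ)).selmerCorank 2 = 1 := by
    rw [hiso.selmerCorank_eq 2, ← selmerCorank_cm7_baseChange h12 K hK.1, hselK]
  have har : (C' • cm7.quadraticTwist (m : ℚ)).analyticRank = 1 := hXL _ hj hbad hsel'
  rw [analyticRankEK_cm7 hmod h12 K, ← analyticRank_eq_of_isIsogenous' hiso, har]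

/-! ## §7 The equivalence, and the parent crux K12₂′ from the leaf -/

/-- **K12₂″ ⟺ the leaf**, granted analytic continuation and Coates–Li–Tian–Zhai Thm. 1.2 at `R = 1`:
the additive cell of the rank-one `2`-converse for the `ℚ(√−7)`-curves IS the `K`-level `2`-converse for
`X₀(49)` over the even-discriminant imaginary quadratic fields.
[cite: CoatesLiTianZhai2015, Thm. 1.2 (p. 359, case r = 0)] [cite: BurungaleCastellaSkinnerTian2022, Rem. D (p. 327)] -/
theorem rankOneTwoConverseCMSevenAdditiveTwo_iff_kLevelEvenDiscr (hmod : hasEntireLFunction_rat)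
    (h12 : CoatesLiTianZhai2015.thm12_fullBSD_twist) :
    Summit.BirchSwinnertonDyer.BirchSwinnertonDyer.Theses.GoldfeldAllTwistsTwoConverse.RankOneTwoConverseCMSevenAdditiveTwo ↔
      X049KLevelTwoConverseEvenDiscr :=
  ⟨kLevelEvenDiscr_of_rankOneTwoConverseCMSevenAdditiveTwo hmod h12,
    rankOneTwoConverseCMSevenAdditiveTwo_of_kLevelEvenDiscr hmod h12⟩

/-- **The parent crux K12₂′ from the leaf** (and BCST Thm. A for the good cell, file 13's
`rankOneTwoConverseCMSevenAtAnyTwo_of_additiveCell`): for every elliptic `W/ℚ` with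
`j ∈ {−3375, 16581375}`, any model, any reduction at `2`, `corank Sel_{2^∞} = 1 ⟹ ord_{s=1} L = 1`.
[cite: BurungaleCastellaSkinnerTian2022, Thm. A (p. 326) and Rem. D (p. 327)]
[cite: CoatesLiTianZhai2015, Thm. 1.2 (p. 359, case r = 0)] -/
theorem rankOneTwoConverseCMSevenAtAnyTwo_of_kLevelEvenDiscr (hmod : hasEntireLFunction_rat)
    (h12 : CoatesLiTianZhai2015.thm12_fullBSD_twist)
    (hA : BurungaleCastellaSkinnerTian2022.thmA_analyticRank_eq_one_of_selmerCorank_eq_one)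
    (hX : X049KLevelTwoConverseEvenDiscr) :
    Summit.BirchSwinnertonDyer.BirchSwinnertonDyer.Theses.GoldfeldAllTwistsTwoConverse.RankOneTwoConverseCMSevenAtAnyTwo :=
  rankOneTwoConverseCMSevenAtAnyTwo_of_additiveCell hA
    (rankOneTwoConverseCMSevenAdditiveTwo_of_kLevelEvenDiscr hmod h12 hX)

end Summit.BirchSwinnertonDyer.BirchSwinnertonDyer.Theorems.GoldfeldGoodTwists

end
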